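import Literature.NumberTheory.Irrationality.Zudilin2014.SecondTalePolar
import Literature.NumberTheory.Irrationality.Zudilin2014.FirstTaleComplex

/-!
# Zudilin 2014, second tale: `R̂(t)` over `ℂ` and its partial fractions

Topic `Literature/NumberTheory/Irrationality/Zudilin2014` [Zudilin2014ZetaTwo, Section 6].  The second-tale rational
function `R̂(â,b̂; t)` of Section 6 as a function on `ℂ` (the Barnes-type integrand of Proposition 3 is
`R̂(t)·π/sin 2πt` on a vertical line), in the style of `FirstTaleComplex.RC`:
[cite: Zudilin2014ZetaTwo, Section 6 (definition of R̂) and Proposition 3]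
* `RCT a b s = numT(s)/denT(s)` (junk `0` at the poles), `aeval_block2_complex`, `aeval_numT_complex`,
  `aeval_denT_complex` (product forms), `aeval_denT_ne_zero` off the poles;
* `RCT_ratCast` — at a rational non-pole `t`, `RCT a b t = RT a b t`;
* **`RCT_eq_polar`** — for admissible parameters and `s` off the poles,
  `R̂(s) = Σ_{k=â₃*}^{b̂₂*−1} A_k/(s+k)² + Σ_{k=â₂*}^{b̂₃*−1} B_k/(s+k)` over `ℂ`
  [cite: Zudilin2014ZetaTwo, Section 6, display before eq. (T2)], from the POLYNOMIAL identity `Ψ = 0` of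
  `SecondTalePF.lean` (`numT = Σ_k polarNum_k`) evaluated at `s`.
PROVED here, 0 `sorry`.  The line integral of Proposition 3 itself is not formalised in this file.

Cell pub-zeta5 (HONEST FRAMING: systematic search; no irrationality claim unless certified).
-/

noncomputable section

open Polynomial Finset Complex

namespace Literature.NumberTheory.Irrationality.Zudilin2014

variable {a b : Fin 4 → ℤ}

/-- **`R̂(â,b̂; s)` over `ℂ`**: `numT(s)/denT(s)` (junk value `0` at the poles `s = −k`).
[cite: Zudilin2014ZetaTwo, Section 6 (definition of R̂)] -/
def RCT (a b : Fin 4 → ℤ) (s : ℂ) : ℂ := aeval s (numT a b) / aeval s (denT a b)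

/-- `aeval s (block2 lo hi) = ∏_{ℓ ∈ [lo,hi)} (2s + ℓ)` over `ℂ`. [cite: Zudilin2014ZetaTwo, Section 6 (definition of R̂)] -/
theorem aeval_block2_complex (lo hi : ℤ) (s : ℂ) :
    aeval s (block2 lo hi) = ∏ l ∈ Ico lo hi, (2 * s + (l : ℂ)) := by
  unfold block2
  rw [map_prod]
  refine prod_congr rfl fun l _ => ?_
  simp [map_ofNat]

/-- `numT(s) = Π̂ · ∏_{ℓ∈[b̂₀,â₀)} (2s+ℓ) · ∏_{i∈[b̂₁,â₁)} (s+i)` over `ℂ`. [cite: Zudilin2014ZetaTwo, Section 6 (definition of R̂)] -/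
theorem aeval_numT_complex (a b : Fin 4 → ℤ) (s : ℂ) :
    aeval s (numT a b) = ((normT a b : ℚ) : ℂ) * ((∏ l ∈ Ico (b 0) (a 0), (2 * s + (l : ℂ)))
      * ∏ i ∈ Ico (b 1) (a 1), (s + (i : ℂ))) := by
  unfold numT
  rw [map_mul, aeval_C, map_mul, aeval_block2_complex, aeval_block_complex, eq_ratCast]

/-- `denT(s) = ∏_{i∈[â₂,b̂₂)} (s+i) · ∏_{i∈[â₃,b̂₃)} (s+i)` over `ℂ`. [cite: Zudilin2014ZetaTwo, Section 6 (definition of R̂)] -/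
theorem aeval_denT_complex (a b : Fin 4 → ℤ) (s : ℂ) :
    aeval s (denT a b) = (∏ i ∈ Ico (a 2) (b 2), (s + (i : ℂ))) * ∏ i ∈ Ico (a 3) (b 3), (s + (i : ℂ)) := by
  unfold denT
  rw [map_mul, aeval_block_complex, aeval_block_complex]

/-- `denT(s) ≠ 0` when `s + k ≠ 0` for every pole index `k`. [cite: Zudilin2014ZetaTwo, Section 6 (poles of R̂)] -/
theorem aeval_denT_ne_zero {s : ℂ} (hs : ∀ k ∈ poleSet a b, s + (k : ℂ) ≠ 0) : aeval s (denT a b) ≠ 0 := by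
  rw [aeval_denT_complex]
  refine mul_ne_zero (prod_ne_zero_iff.2 fun i hi => hs i ?_) (prod_ne_zero_iff.2 fun i hi => hs i ?_)
  · exact mem_union_left _ hi
  · exact mem_union_right _ hi

/-- At a rational point, `aeval` is the cast of `eval`. [folklore] -/
private theorem aeval_ratCast_eq (p : ℚ[X]) (t : ℚ) : aeval (t : ℂ) p = ((p.eval t : ℚ) : ℂ) := by
  have h := aeval_algebraMap_apply_eq_algebraMap_eval (A := ℂ) t p
  simpa [eq_ratCast] using h

/-- **`R̂` at a rational non-pole is the cast of `RT`.** [cite: Zudilin2014ZetaTwo, Section 6 (definition of R̂)] -/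
theorem RCT_ratCast (a b : Fin 4 → ℤ) (t : ℚ) : RCT a b (t : ℂ) = ((RT a b t : ℚ) : ℂ) := by
  unfold RCT RT
  rw [aeval_ratCast_eq, aeval_ratCast_eq]
  push_cast
  rfl

/-- `denT(s) = dhatT_k(s) · (s+k)^{μ_k}` over `ℂ`. [cite: Zudilin2014ZetaTwo, Section 6, eq. (T2)] -/
theorem aeval_denT_eq_dhatT_mul (a b : Fin 4 → ℤ) (k : ℤ) (s : ℂ) :
    aeval s (denT a b) = aeval s (dhatT a b k) * (s + (k : ℂ)) ^ multT a b k := by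
  rw [denT_eq_dhatT_mul a b k, map_mul, map_pow, map_add, aeval_X, aeval_C, eq_ratCast, Rat.cast_intCast]

/-- One polar block over `ℂ`: `polarNum_k(s)/denT(s) = A_k/(s+k)² + B_k/(s+k)` for a pole `k` with `s + k ≠ 0`.
[cite: Zudilin2014ZetaTwo, Section 6, display before eq. (T2)] -/
theorem aeval_polarNum_div {k : ℤ} (hk : k ∈ poleSet a b) {s : ℂ} (hs : ∀ j ∈ poleSet a b, s + (j : ℂ) ≠ 0) :
    aeval s (polarNum a b k) / aeval s (denT a b)
      = ((coefAT a b k : ℚ) : ℂ) / (s + (k : ℂ)) ^ 2 + ((coefBT a b k : ℚ) : ℂ) / (s + (k : ℂ)) := by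
  have hμ := one_le_multT_of_mem hk
  have hμ2 := multT_le_two a b k
  have hden := aeval_denT_ne_zero hs
  have hsk : s + (k : ℂ) ≠ 0 := hs k hk
  have hdh : aeval s (dhatT a b k) ≠ 0 := by
    intro h; apply hden; rw [aeval_denT_eq_dhatT_mul a b k, h, zero_mul]
  unfold polarNum
  rw [aeval_denT_eq_dhatT_mul a b k, map_mul, map_add, aeval_C, map_mul, aeval_C, map_pow, map_add, aeval_X,
    aeval_C, eq_ratCast, eq_ratCast, eq_ratCast, Rat.cast_intCast]
  rcases (show multT a b k = 1 ∨ multT a b k = 2 by omega) with h1 | h2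
  · rw [h1, coefAT_of_simple h1]
    simp only [Nat.sub_self, pow_zero, mul_one, Rat.cast_zero, zero_add, pow_one, zero_div]
    field_simp
  · rw [h2]
    simp only [show (2 : ℕ) - 1 = 1 from rfl, pow_one]
    field_simp

/-- **Partial fractions of `R̂` over `ℂ` (pole set).** [cite: Zudilin2014ZetaTwo, Section 6, display before eq. (T2)] -/
theorem RCT_eq_polar_blocks (hab : AdmissibleT a b) {s : ℂ} (hs : ∀ j ∈ poleSet a b, s + (j : ℂ) ≠ 0) :
    RCT a b s = ∑ k ∈ poleSet a b, (((coefAT a b k : ℚ) : ℂ) / (s + (k : ℂ)) ^ 2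
      + ((coefBT a b k : ℚ) : ℂ) / (s + (k : ℂ))) := by
  have hΨ := psiPoly_eq_zero hab
  unfold psiPoly at hΨ
  rw [sub_eq_zero] at hΨ
  unfold RCT
  rw [hΨ, map_sum, sum_div]
  exact sum_congr rfl fun k hk => aeval_polarNum_div hk hs

/-- **Partial fractions of `R̂` over `ℂ` (Zudilin's ranges)**: for admissible parameters and `s` off the poles,
`R̂(s) = Σ_{k=â₃*}^{b̂₂*−1} A_k/(s+k)² + Σ_{k=â₂*}^{b̂₃*−1} B_k/(s+k)`.
[cite: Zudilin2014ZetaTwo, Section 6, display before eq. (T2)] -/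
theorem RCT_eq_polar (hab : AdmissibleT a b) {s : ℂ} (hs : ∀ j ∈ poleSet a b, s + (j : ℂ) ≠ 0) :
    RCT a b s = ∑ k ∈ Ico (aMax3 a) (bMin b), ((coefAT a b k : ℚ) : ℂ) / (s + (k : ℂ)) ^ 2
      + ∑ k ∈ Ico (aMid a) (bMax b), ((coefBT a b k : ℚ) : ℂ) / (s + (k : ℂ)) := by
  obtain ⟨hA, hB⟩ := ranges_subset_poleSet hab
  rw [RCT_eq_polar_blocks hab hs, sum_add_distrib]
  congr 1
  · refine (sum_subset hA fun k hk hk' => ?_).symm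
    rw [coefAT_eq_zero_of_not_mem hab hk hk', Rat.cast_zero, zero_div]
  · refine (sum_subset hB fun k hk hk' => ?_).symm
    rw [coefBT_eq_zero_of_not_mem hab hk hk', Rat.cast_zero, zero_div]

/-- Off the real axis there are no poles: `s + k ≠ 0` whenever `Im s ≠ 0`. [folklore] -/
private theorem add_intCast_ne_zero_of_im {s : ℂ} (hs : s.im ≠ 0) (k : ℤ) : s + (k : ℂ) ≠ 0 := by
  intro h
  have := congrArg Complex.im h
  simp at this
  exact hs this

/-- **Partial fractions of `R̂` on vertical lines** (`Im s ≠ 0`). [cite: Zudilin2014ZetaTwo, Section 6, display before eq. (T2)] -/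
theorem RCT_eq_polar_of_im (hab : AdmissibleT a b) {s : ℂ} (hs : s.im ≠ 0) :
    RCT a b s = ∑ k ∈ Ico (aMax3 a) (bMin b), ((coefAT a b k : ℚ) : ℂ) / (s + (k : ℂ)) ^ 2
      + ∑ k ∈ Ico (aMid a) (bMax b), ((coefBT a b k : ℚ) : ℂ) / (s + (k : ℂ)) :=
  RCT_eq_polar hab fun j _ => add_intCast_ne_zero_of_im hs j

end Literature.NumberTheory.Irrationality.Zudilin2014

end
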